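import Mathlib
import HarnessLib

/-!
# Crux `DigitPolyUniformity` (stmt-QuantumAdvantage-1392), line `Sketch`, cycle 6 — Stub F

Interpolation in the `K` low digits: a `±1`-function `f` of `N mod 2^K` is `χ_P(N) = (−1)^{P(bits N)}` for a
polynomial `P ∈ 𝔽₂[x_0, …, x_{n−1}]` of total degree `≤ K` (`K ≤ n`), namely
`P = Σ_{r < 2^K, f(r) = −1} 1_{bits r}` with the point indicators
`1_{bits r} = Π_{i<K} (x_i if bit_i(r) = 1, else 1 + x_i)` of `𝔽₂^K` in the variables `x_0, …, x_{K−1}`.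
(The digit factors and point indicators are written out explicitly, no auxiliary definitions.)
-/

noncomputable section

namespace Summit.QuantumAdvantage.DigitPolyUniformity.SketchLAR.Chirp

open Finset

/-- A digit factor (`x_i` if `b`, else `1 + x_i`) has total degree `≤ 1`. [folklore] -/
private lemma totalDegree_digitFactor_le (n : ℕ) (i : Fin n) (b : Bool) :
    ((if b then MvPolynomial.X i else 1 + MvPolynomial.X i : MvPolynomial (Fin n) (ZMod 2))).totalDegree
      ≤ 1 := by
  split_ifs
  · exact (MvPolynomial.totalDegree_X _).le
  · refine (MvPolynomial.totalDegree_add _ _).trans ?_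
    rw [MvPolynomial.totalDegree_one, MvPolynomial.totalDegree_X]
    simp

/-- At the bits of `N`, the digit factor evaluates to `1` if the `i`-th bit of `N` is `b`, else to `0`. [folklore] -/
private lemma eval_digitFactor (n : ℕ) (i : Fin n) (b : Bool) (N : ℕ) :
    MvPolynomial.eval (fun j : Fin n => if Nat.testBit N j then (1 : ZMod 2) else 0)
        (if b then MvPolynomial.X i else 1 + MvPolynomial.X i : MvPolynomial (Fin n) (ZMod 2)) =
      if Nat.testBit N i = b then 1 else 0 := by
  have h2 : (1 : ZMod 2) + 1 = 0 := by decide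
  cases b <;> cases hNi : Nat.testBit N i <;> simp [hNi, h2]

/-- A point indicator `Π_{i<K} (digit factor of bit_i(r))` in `K` digits has total degree `≤ K`. [folklore] -/
private lemma totalDegree_pointIndicator_le (K n : ℕ) (hKn : K ≤ n) (r : ℕ) :
    (∏ i : Fin K, (if Nat.testBit r i then MvPolynomial.X (Fin.castLE hKn i)
        else 1 + MvPolynomial.X (Fin.castLE hKn i) : MvPolynomial (Fin n) (ZMod 2))).totalDegree ≤ K := by
  refine (MvPolynomial.totalDegree_finsetProd _ _).trans ?_
  calc ∑ i : Fin K, (if Nat.testBit r i then MvPolynomial.X (Fin.castLE hKn i)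
          else 1 + MvPolynomial.X (Fin.castLE hKn i) : MvPolynomial (Fin n) (ZMod 2)).totalDegree
      ≤ ∑ _i : Fin K, 1 := Finset.sum_le_sum (fun i _ => totalDegree_digitFactor_le _ _ _)
    _ = K := by simp

/-- At the bits of `N`, the point indicator of `r < 2^K` evaluates to `[N mod 2^K = r]`. [folklore] -/
private lemma eval_pointIndicator (K n : ℕ) (hKn : K ≤ n) (r : ℕ) (hr : r < 2 ^ K) (N : ℕ) :
    MvPolynomial.eval (fun j : Fin n => if Nat.testBit N j then (1 : ZMod 2) else 0)
        (∏ i : Fin K, (if Nat.testBit r i then MvPolynomial.X (Fin.castLE hKn i)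
          else 1 + MvPolynomial.X (Fin.castLE hKn i) : MvPolynomial (Fin n) (ZMod 2))) =
      if N % 2 ^ K = r then 1 else 0 := by
  rw [map_prod]
  simp_rw [eval_digitFactor]
  rw [Finset.prod_boole]
  have key : (∀ i ∈ (Finset.univ : Finset (Fin K)),
      Nat.testBit N (Fin.castLE hKn i : ℕ) = Nat.testBit r i) ↔ N % 2 ^ K = r := by
    constructor
    · intro h
      apply Nat.eq_of_testBit_eq
      intro j
      rw [Nat.testBit_mod_two_pow]
      by_cases hj : j < K
      · simpa [hj] using h ⟨j, hj⟩ (Finset.mem_univ _)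
      · have hrj : r < 2 ^ j := lt_of_lt_of_le hr (Nat.pow_le_pow_right (by norm_num) (not_lt.1 hj))
        simp [hj, Nat.testBit_lt_two_pow hrj]
    · intro h i _
      rw [← h, Fin.val_castLE, Nat.testBit_mod_two_pow]
      simp [i.2]
  by_cases hNr : N % 2 ^ K = r
  · rw [if_pos hNr, if_pos (key.2 hNr)]
  · rw [if_neg hNr, if_neg (mt key.1 hNr)]

/-- **Stub F (interpolation in the `K` low digits).** A `±1`-function of `N mod 2^K` is `χ_P(N) = (−1)^{P(bits N)}`
for a polynomial `P ∈ 𝔽₂[x_0, …, x_{n−1}]` of total degree `≤ K` (`K ≤ n`): `P = Σ_{r<2^K, f(r)=−1} 1_{bits r}` with the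
point indicators of `𝔽₂^K` in the variables `x_0, …, x_{K−1}`. [folklore] -/
theorem stub_interp (K n : ℕ) (hKn : K ≤ n) (f : ℕ → ℝ) (hf1 : ∀ r, f r = 1 ∨ f r = -1)
    (hper : ∀ r, f (r % 2 ^ K) = f r) :
    ∃ P : MvPolynomial (Fin n) (ZMod 2), P.totalDegree ≤ K ∧ ∀ N : ℕ,
      (if MvPolynomial.eval (fun i : Fin n => if Nat.testBit N i then (1 : ZMod 2) else 0) P = 1
        then (-1 : ℝ) else 1) = f N := by
  classical
  refine ⟨∑ r ∈ (range (2 ^ K)).filter (fun r => f r = -1),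
    ∏ i : Fin K, (if Nat.testBit r i then MvPolynomial.X (Fin.castLE hKn i)
      else 1 + MvPolynomial.X (Fin.castLE hKn i) : MvPolynomial (Fin n) (ZMod 2)), ?_, ?_⟩
  · exact MvPolynomial.totalDegree_finsetSum_le (fun r _ => totalDegree_pointIndicator_le K n hKn r)
  · intro N
    have heval : MvPolynomial.eval (fun i : Fin n => if Nat.testBit N i then (1 : ZMod 2) else 0)
        (∑ r ∈ (range (2 ^ K)).filter (fun r => f r = -1),
          ∏ i : Fin K, (if Nat.testBit r i then MvPolynomial.X (Fin.castLE hKn i)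
            else 1 + MvPolynomial.X (Fin.castLE hKn i) : MvPolynomial (Fin n) (ZMod 2))) =
        if f N = -1 then 1 else 0 := by
      rw [map_sum]
      have hpt : ∀ r ∈ (range (2 ^ K)).filter (fun r => f r = -1),
          MvPolynomial.eval (fun i : Fin n => if Nat.testBit N i then (1 : ZMod 2) else 0)
            (∏ i : Fin K, (if Nat.testBit r i then MvPolynomial.X (Fin.castLE hKn i)
              else 1 + MvPolynomial.X (Fin.castLE hKn i) : MvPolynomial (Fin n) (ZMod 2))) =
            if N % 2 ^ K = r then 1 else 0 := fun r hr =>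
        eval_pointIndicator K n hKn r (Finset.mem_range.1 (Finset.mem_filter.1 hr).1) N
      rw [Finset.sum_congr rfl hpt, Finset.sum_ite_eq]
      have hmem : N % 2 ^ K ∈ (range (2 ^ K)).filter (fun r => f r = -1) ↔ f N = -1 := by
        rw [Finset.mem_filter, Finset.mem_range, hper]
        exact ⟨fun h => h.2, fun h => ⟨Nat.mod_lt _ (Nat.two_pow_pos K), h⟩⟩
      by_cases hN : f N = -1
      · rw [if_pos hN, if_pos (hmem.2 hN)]
      · rw [if_neg hN, if_neg (mt hmem.1 hN)]
    rw [heval]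
    rcases hf1 N with hN | hN
    · have h10 : ¬ ((if (1 : ℝ) = -1 then (1 : ZMod 2) else 0) = 1) := by norm_num
      rw [hN, if_neg h10]
    · rw [hN, if_pos rfl, if_pos rfl]

end Summit.QuantumAdvantage.DigitPolyUniformity.SketchLAR.Chirp

end
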